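import Literature.NumberTheory.NumberFields.RayClassFieldLocalTowerContainment
import Literature.NumberTheory.GaloisRepresentations.LocalWeilDatumDegree
import Literature.NumberTheory.GaloisRepresentations.UnramifiedKummer
import HarnessLib

/-!
# The local tower contains the global one — unramified-base form: `f ∣ f_E` suffices
# (de Shalit II.1.10 / I.1.8; Neukirch IV §4: `f_E ∣ deg w` for `w ∈ W_{K_v}` fixing `E`)

Sequel of `RayClassFieldLocalTowerContainment.lean`.  There the field-form containment `ι(K(𝔪v^{n+1})) ⊆ E ⊔ ltField π n`
was proved under the hypothesis `hdegE : ∀ w, toAbsGalois w fixes E → f ∣ deg w`.  THIS file discharges `hdegE` from the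
residue degree: for a finite `E ⊆ K̄_v` with residue degree `f_E = inertiaDeg' 𝓂[K_v] 𝔓_E` and `f ∣ f_E`, every local Weil
element fixing `E` has `f ∣ f_E ∣ deg w` (tree `LocalWeilDatum.inertiaDeg_dvd_deg_of_mem_fieldSubgroup`, Neukirch IV §4),
whence ★ `absClosureEmbedding_mem_sup_ltField_of_dvd_inertiaDeg` — the containment for every such `E` (e.g. `E` unramified
of degree divisible by `f`, in particular `E ⊇ ι(K(𝔪))·K_v`); and §2 ★ `absClosureEmbedding_mem_maxUnramified_of_mem_rayClassField`
— **`ι(K(𝔪)) ⊆ K_v^{nr}` for `v ∤ 𝔪`** (the ray class field is unramified at `v`, local form: the absolute inertia of `K_v` is the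
image of the Weil inertia, whose elements restrict into `Gal(K̄/K(𝔪))` — `absGaloisRestrict_toAbsGalois_mem_ker_rayClassField`),
with `adjoin_image_rayClassField_le_maxUnramified` (the base `Φ_𝔪 = K_v·ι(K(𝔪)) ≤ K_v^{nr}` of de Shalit II.4.3).
Theorems only; no `sorry`.

## References
* [deShalit1987] E. de Shalit, *Iwasawa theory of elliptic curves with complex multiplication* (1987), II.1.10 (p. 39), I.1.8 (p. 11).
* [NeukirchANT1999] J. Neukirch, *Algebraic Number Theory* (1999), Ch. IV §4 (`f_K ∣ deg`).
-/

noncomputable section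

open NumberField IsDedekindDomain IsDedekindDomain.HeightOneSpectrum Field
open scoped nonZeroDivisors Classical

namespace Literature.NumberTheory.NumberFields

open Literature.NumberTheory.GaloisRepresentations
open Literature.NumberTheory.GaloisRepresentations.IsNonarchimedeanLocalField

variable {K : Type} [Field K] [NumberField K] {𝔪 : Ideal (𝓞 K)} {v : HeightOneSpectrum (𝓞 K)}

omit [NumberField K] in
/-- An element of `ker (res_L)` fixes `L` pointwise. [folklore] -/
private theorem smul_eq_of_mem_ker_absRestrictNormalHom₉' (L : IntermediateField K (AlgebraicClosure K)) [Normal K L]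
    {τ : absoluteGaloisGroup K} (hτ : τ ∈ (absRestrictNormalHom L).ker) {x : AlgebraicClosure K} (hx : x ∈ L) :
    τ • x = x := by
  rw [MonoidHom.mem_ker] at hτ
  have h : ((absRestrictNormalHom L τ ⟨x, hx⟩ : L) : AlgebraicClosure K) = τ • x := AlgEquiv.restrictNormalHom_apply L _ _
  rw [← h, hτ, AlgEquiv.one_apply]


open ValuativeRel in
/-- **`f ∣ f_E ⟹ f ∣ deg w` for every local Weil element fixing `E`** (`f_E = inertiaDeg' 𝓂[K_v] 𝔓_E`).
[cite: NeukirchANT1999, Ch. IV §4] -/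
theorem dvd_deg_of_mem_fixingSubgroup_of_dvd_inertiaDeg
    (E : IntermediateField (v.adicCompletion K) (AlgebraicClosure (v.adicCompletion K)))
    [FiniteDimensional (v.adicCompletion K) E] {f : ℕ}
    (hfE : (f : ℤ) ∣ (Ideal.inertiaDeg' (IsLocalRing.maximalIdeal 𝒪[v.adicCompletion K])
      (LocalWeilDatum.primeOf (v.adicCompletion K) E) : ℤ))
    (w : WeilGroup (v.adicCompletion K)) (hw : WeilGroup.toAbsGalois (v.adicCompletion K) w ∈ E.fixingSubgroup) :
    (f : ℤ) ∣ WeilGroup.deg w := by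
  refine hfE.trans (LocalWeilDatum.inertiaDeg_dvd_deg_of_mem_fieldSubgroup (v.adicCompletion K) E ?_)
  rw [LocalWeilDatum.mem_fieldSubgroup_iff]
  intro x hx
  rw [Field.absoluteGaloisGroup.smul_def]
  exact (IntermediateField.mem_fixingSubgroup_iff _ _).mp hw x hx

variable [IsTotallyComplex K]

open ValuativeRel in
/-- ★ **THE LOCAL TOWER CONTAINS THE GLOBAL ONE for every finite normal `E ⊆ K̄_v` with `f ∣ f_E`** (`π` a uniformiser of
`K_v`, `α ∈ 𝓞_K` with `α ≠ 0`, `α ≡ 1 mod 𝔪`, `(α) = 𝔭_v^f`, `α = π^f` in `K_v`): `ι(K(𝔪v^{n+1})) ⊆ E ⊔ ltField π n`.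
[cite: deShalit1987, II.1.10 Lemma (p. 39), I.1.8 (p. 11)] [cite: NeukirchANT1999, Ch. IV §4] -/
theorem absClosureEmbedding_mem_sup_ltField_of_dvd_inertiaDeg (h𝔪 : 𝔪 ≠ ⊥) (hv : ¬ 𝔪 ≤ v.asIdeal)
    {π : 𝒪[v.adicCompletion K]} (hπ : (valuation (v.adicCompletion K)).IsUniformizer (π : v.adicCompletion K))
    {α : 𝓞 K} (hα0 : α ≠ 0) (hα𝔪 : α - 1 ∈ 𝔪) (hαw : ∀ w : HeightOneSpectrum (𝓞 K), w ≠ v → α ∉ w.asIdeal)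
    {f : ℕ} (hαπ : ((α : K) : v.adicCompletion K) = (π : v.adicCompletion K) ^ f)
    (E : IntermediateField (v.adicCompletion K) (AlgebraicClosure (v.adicCompletion K)))
    [FiniteDimensional (v.adicCompletion K) E] [Normal (v.adicCompletion K) E]
    (hfE : (f : ℤ) ∣ (Ideal.inertiaDeg' (IsLocalRing.maximalIdeal 𝒪[v.adicCompletion K])
      (LocalWeilDatum.primeOf (v.adicCompletion K) E) : ℤ))
    (n : ℕ) {x : AlgebraicClosure K} (hx : x ∈ rayClassField K (𝔪 * v.asIdeal ^ (n + 1))) :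
    absClosureEmbedding K (v.adicCompletion K) x ∈
      (E ⊔ ltField π n : IntermediateField (v.adicCompletion K) (AlgebraicClosure (v.adicCompletion K))) :=
  absClosureEmbedding_mem_sup_ltField_of_mem_rayClassField_mul_pow h𝔪 hv hπ hα0 hα𝔪 hαw hαπ E
    (dvd_deg_of_mem_fixingSubgroup_of_dvd_inertiaDeg E hfE) n hx

/-! ### §2. `ι(K(𝔪)) ⊆ K_v^{nr}`: the ray class field of modulus prime to `v` is unramified at `v` (local form) -/

omit [IsTotallyComplex K] in
/-- ★ **`ι(K(𝔪)) ⊆ K_v^{nr}` for `v ∤ 𝔪`**: every element of the absolute inertia group of `K_v` — the image of the Weil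
inertia (`WeilGroup.inertia_map_toAbsGalois`) — restricts into `Gal(K̄/K(𝔪))` (`absGaloisRestrict_toAbsGalois_mem_ker_rayClassField`,
`K(𝔪)/K` unramified at `v`), so fixes `ι(K(𝔪))`; and `K_v^{nr}` is the fixed field of the inertia
(`mem_absInertia_iff_forall_mem_maxUnramified` + the Galois correspondence). This is the base `Φ = K(𝔣)_𝔓 ⊆ K_𝔭^{nr}` of
de Shalit II.4.3. [cite: deShalit1987, II.4.3 (p. 57), II.1.10 (p. 39)] [cite: NeukirchANT1999, Ch. VI §7 Thm. (7.1), §5 Prop. (5.6)] -/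
theorem absClosureEmbedding_mem_maxUnramified_of_mem_rayClassField (h𝔪 : 𝔪 ≠ ⊥) (hv : ¬ 𝔪 ≤ v.asIdeal)
    {x : AlgebraicClosure K} (hx : x ∈ rayClassField K 𝔪) :
    absClosureEmbedding K (v.adicCompletion K) x ∈ maxUnramified (v.adicCompletion K) := by
  haveI : CharZero (v.adicCompletion K) :=
    charZero_of_injective_algebraMap (algebraMap K (v.adicCompletion K)).injective
  haveI : IsGalois (v.adicCompletion K) (AlgebraicClosure (v.adicCompletion K)) :=
    IsAlgClosure.isGalois (v.adicCompletion K) (AlgebraicClosure (v.adicCompletion K))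
  rw [← InfiniteGalois.fixedField_fixingSubgroup (maxUnramified (v.adicCompletion K)),
    IntermediateField.mem_fixedField_iff]
  intro τ hτ
  -- `τ` lies in the absolute inertia, the image of the Weil inertia
  have hτI : (absoluteGaloisGroup.toAlgEquiv (v.adicCompletion K)).symm τ ∈ absInertia (v.adicCompletion K) :=
    mem_absInertia_iff_forall_mem_maxUnramified.2 fun z hz ↦ (IntermediateField.mem_fixingSubgroup_iff _ _).1 hτ z hz
  rw [← WeilGroup.inertia_map_toAbsGalois, Subgroup.mem_map] at hτI
  obtain ⟨w, hwI, hwτ⟩ := hτI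
  have hker := absGaloisRestrict_toAbsGalois_mem_ker_rayClassField h𝔪 hv
    (isLocalArtinMap_canonicalArtin_holds (v.adicCompletion K)) hwI
  have hfix := congrArg (absClosureEmbedding K (v.adicCompletion K))
    (smul_eq_of_mem_ker_absRestrictNormalHom₉' (rayClassField K 𝔪) hker hx)
  rw [absGaloisRestrict_apply_smul, hwτ] at hfix
  -- `((toAlgEquiv).symm τ) • y = τ y`
  exact hfix

omit [IsTotallyComplex K] in
/-- **`K_v·ι(K(𝔪)) ≤ K_v^{nr}`**: the unramified base `Φ_𝔪` generated over `K_v` by the image of `K(𝔪)`.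
[cite: deShalit1987, II.4.3 (p. 57)] -/
theorem adjoin_image_rayClassField_le_maxUnramified (h𝔪 : 𝔪 ≠ ⊥) (hv : ¬ 𝔪 ≤ v.asIdeal) :
    IntermediateField.adjoin (v.adicCompletion K)
        (absClosureEmbedding K (v.adicCompletion K) '' (rayClassField K 𝔪 : Set (AlgebraicClosure K))) ≤
      maxUnramified (v.adicCompletion K) := by
  rw [IntermediateField.adjoin_le_iff]
  rintro _ ⟨x, hx, rfl⟩
  exact absClosureEmbedding_mem_maxUnramified_of_mem_rayClassField h𝔪 hv hx

end Literature.NumberTheory.NumberFields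

end
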